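import Literature.Topology.PlanarFoliations.BandOpen
import Literature.Topology.PlanarFoliations.CirclePowers
import Literature.Topology.PlanarFoliations.ClosedLeafCrossings
import Literature.Topology.FourManifolds.TautFoliationsVanishingCycle
import HarnessLib

/-!
# A vanishing cycle from an essential compact leaf bordering a band of image-null leaves

Topic: Topology / PlanarFoliations. Let `F` be a bi-oriented, transversely oriented foliation
of a plane domain `X ↪ ℂ`, `f` a foliated map from `(X, F)` to a `C⁰` codimension-one foliation
`T` of `M` (`TautFoliationsFoliatedMaps.lean`), and `E` a compact leaf of `F` with injective
leaf loop `γ` based at `x₀ ∈ e₀.source`, whose image loop `f ∘ γ` is **not** null-homotopic in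
its leaf of `T`, and such that the points `V τ = e₀⁻¹(b₀, τ)` of the vertical through `x₀` have
**image-null compact leaves** (`ImageNull`, `BandOpen.lean`) for all levels `τ` strictly on
one side of `τ₀ = h_{e₀}(x₀)` and close to it. Then **`T` has a vanishing cycle starting at
`f ∘ γ`** (`exists_vanishingCycle`): this is the conclusion of the proof of Camacho–Lins Neto,
*Geometric Theory of Foliations*, Ch. VII §2 Prop. 1 ("the leaf `∂V₂` is the vanishing cycle we
are looking for"), made exact for `C⁰` foliations with fences.

The family is `f_t(θ) = f (Φ θ (τ₀ + sg·t))`, `sg = ±1`, `Φ` the suspension fence over `γ`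
(`IsTransverselyOriented.exists_suspensionFence`):

* the fence **closes up on the band side** (`Φ 1 τ = Φ 0 τ = V τ`): its horizontal at level
  `τ` runs in the leaf of `V τ`, which is compact, and a compact leaf crosses the vertical of a
  flow box only once (`compactLeaf_vert_subsingleton`, `ClosedLeafCrossings.lean`), so the
  return point `V (ψ₁ τ)` is `V τ`;
* `f_0 = f ∘ γ` is essential by hypothesis; for `t > 0` the horizontal is a loop of the
  compact leaf of `V τ`, whose injective leaf loop has null-homotopic image
  (`ImageNull.map_loop`), hence so has every loop of that leaf
  (`CircleLoops.map_homotopic_refl_of_map_loop'`, `CirclePowers.lean`);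
* the composite `f ∘ Φ` is a fence of `T` (`IsFoliatedMap.exists_isFenceOn_comp`,
  `TautFoliationsFencePush.lean`), whose verticals have injective transverse coordinate in
  its local data — the transversality of `t ↦ f_t(θ)`.

* `exists_vanishingCycle` (**proved**).

## References

* C. Camacho, A. Lins Neto, *Geometric Theory of Foliations*, Birkhäuser (1985), Ch. VII §2
  Prop. 1 [CamachoLinsNeto1985].
-/

noncomputable section

open Set Filter Function
open _root_.Topology unitInterval
open Literature.Topology.FourManifolds Literature.Topology.FourManifolds.Foliation

namespace Literature.Topology.PlanarFoliations

variable {X : Type*} [TopologicalSpace X] [T2Space X] [SecondCountableTopology X] {F : Foliation ℝ X}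
variable {B : Type*} [NormedAddCommGroup B] {M : Type*} [TopologicalSpace M]
  {T : Foliation B M} {f : X → M}
variable {x : X} {γ : ℝ → F.Leaf x} {e₀ : OpenPartialHomeomorph X (ℝ × ℝ)} {ι : X → ℂ}

/-- **A vanishing cycle from an essential compact leaf bordering a band of image-null leaves**
(Camacho–Lins Neto, Ch. VII §2 Prop. 1, conclusion). See the module docstring; `sg = ±1`
selects the side of the band. [cite: CamachoLinsNeto1985, Ch. VII §2 Prop. 1] -/
theorem exists_vanishingCycle (hbi : IsBiOriented F) (hι : IsOpenEmbedding ι) (ho : F.IsTransverselyOriented)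
    (hf : IsFoliatedMap F T f) (hc : Continuous γ) (hp : Periodic γ 1) (he₀ : e₀ ∈ F.atlas)
    (hx₀ : loopBase γ ∈ e₀.source)
    (hess : ¬ ((F.leafLoop (loopPath γ hc hp) (continuous_toLeafSpace_loopPath γ hc hp)).map
      hf.continuous_leafMap).Homotopic (Path.refl _))
    {sg : ℝ} (hsg : sg = 1 ∨ sg = -1) {δ : ℝ} (hδ : 0 < δ)
    (hband : ∀ t ∈ Ioo 0 δ, ImageNull hf (vert γ e₀ (baseLevel γ e₀ + sg * t))) :
    ∃ C : T.VanishingCycle, ∀ θ, C.fam 0 θ = f (loopPath γ hc hp θ) := by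
  haveI : Nontrivial X := nontrivial_of_foliation F x
  obtain ⟨ε, φ₁, ψ₁, Γ, Φ, hε, -, -, -, -, -, hψ0, -, -, hΓ, -, hΦ, h0, h1⟩ :=
    ho.exists_suspensionFence (loopPath γ hc hp) (continuous_toLeafSpace_loopPath γ hc hp) he₀ hx₀
  -- the pushed fence of `T`
  obtain ⟨δ₁, hδ₁, hδ₁ε, hΦT⟩ := hf.exists_isFenceOn_comp Γ hε hΦ
  -- notation
  have hτ₀ : (e₀ (loopBase γ)).2 = baseLevel γ e₀ := rfl
  have hb₀ : (e₀ (loopBase γ)).1 = baseCoord γ e₀ := rfl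
  rw [hτ₀] at hΦ hΦT h0 h1 hψ0
  rw [hb₀] at h0 h1
  set τ₀ := baseLevel γ e₀ with hτ₀def
  have hsgabs : |sg| = 1 := by rcases hsg with rfl | rfl <;> simp
  have hsg0 : sg ≠ 0 := fun h ↦ by rw [h, abs_zero] at hsgabs; exact zero_ne_one hsgabs
  -- the parameter interval
  set ε' : ℝ := min δ₁ δ with hε'def
  have hε' : 0 < ε' := lt_min hδ₁ hδ
  have hlev₁ : ∀ {t : ℝ}, t ∈ Ico 0 ε' → τ₀ + sg * t ∈ Ioo (τ₀ - δ₁) (τ₀ + δ₁) := fun {t} ht ↦ by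
    have h₁ : |sg * t| < δ₁ := by
      rw [abs_mul, hsgabs, one_mul, abs_of_nonneg ht.1]
      exact ht.2.trans_le (min_le_left _ _)
    constructor <;> linarith [(abs_lt.1 h₁).1, (abs_lt.1 h₁).2]
  have hlev : ∀ {t : ℝ}, t ∈ Ico 0 ε' → τ₀ + sg * t ∈ Ioo (τ₀ - ε) (τ₀ + ε) := fun ht ↦
    ⟨by linarith [(hlev₁ ht).1], by linarith [(hlev₁ ht).2]⟩
  -- the fence closes up on the band: `ψ₁ = id` there
  have hψid : ∀ {t : ℝ}, t ∈ Ico 0 ε' → ψ₁ (τ₀ + sg * t) = τ₀ + sg * t := by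
    intro t ht
    rcases ht.1.eq_or_lt with h | h
    · rw [← h, mul_zero, add_zero, hψ0]
    · have hτ := hlev ht
      have hIN : ImageNull hf (vert γ e₀ (τ₀ + sg * t)) := hband t ⟨h, ht.2.trans_le (min_le_right _ _)⟩
      have hK : IsCompact (F.leaf (vert γ e₀ (τ₀ + sg * t))) := hIN.isCompact_leaf
      -- `Φ 1 τ = V (ψ₁ τ)` lies in the leaf of `Φ 0 τ = V τ`
      have hmem : e₀.symm (baseCoord γ e₀, ψ₁ (τ₀ + sg * t)) ∈ F.leaf (vert γ e₀ (τ₀ + sg * t)) := by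
        rw [← h1 _ hτ, vert_def, ← h0 _ hτ]
        exact hΦ.mem_leaf hτ 0 1
      exact compactLeaf_vert_subsingleton hbi hι hK he₀ hmem (F.mem_leaf_self _)
  have hclosed : ∀ {t : ℝ}, t ∈ Ico 0 ε' → Φ 1 (τ₀ + sg * t) = Φ 0 (τ₀ + sg * t) := fun ht ↦ by
    rw [h1 _ (hlev ht), h0 _ (hlev ht), hψid ht]
  -- the family
  set fam : ℝ → I → M := fun t θ ↦ f (Φ θ (τ₀ + sg * t)) with hfam
  have hleafwise : ∀ t ∈ Ico 0 ε', Continuous (toLeafSpace ∘ fam t : I → T.LeafSpace) := fun t ht ↦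
    hf.continuous_leafMap.comp (hΦ.continuous_toLeafSpace (hlev ht))
  have hcl : ∀ t ∈ Ico 0 ε', fam t 1 = fam t 0 := fun t ht ↦ by
    show f (Φ 1 (τ₀ + sg * t)) = f (Φ 0 (τ₀ + sg * t))
    rw [hclosed ht]
  -- at `t = 0` the family is `f ∘ γ`
  have hfam0 : ∀ θ, fam 0 θ = f (loopPath γ hc hp θ) := fun θ ↦ by
    show f (Φ θ (τ₀ + sg * 0)) = _
    rw [mul_zero, add_zero, hΦ.base θ (mem_univ θ)]
    exact congrArg f (congrArg ofLeafSpace (congr_fun hΓ θ))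
  refine ⟨{ ε := ε'
            ε_pos := hε'
            fam := fam
            continuousOn := ?_
            closed := hcl
            leafwise := hleafwise
            not_homotopic_zero := fun H ↦ hess ?_
            homotopic_refl := fun t ht ↦ ?_
            transverse := fun θ t ht ↦ ?_ }, hfam0⟩
  · -- joint continuity
    have hmaps : MapsTo (fun p : ℝ × I ↦ (p.2, τ₀ + sg * p.1)) (Ico 0 ε' ×ˢ univ)
        (univ ×ˢ Ioo (τ₀ - ε) (τ₀ + ε)) := fun p hp ↦ ⟨mem_univ _, hlev hp.1⟩
    have h := hΦ.cont.comp (continuous_snd.prodMk (continuous_const.add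
      (continuous_const.mul continuous_fst))).continuousOn hmaps
    exact hf.continuous.comp_continuousOn h
  · -- essential at `t = 0`: transport along `fam 0 = f ∘ γ`
    have e : toLeafSpace (fam 0 0) = leafMap F T f (toLeafSpace (loopBase γ)) := congrArg toLeafSpace (hfam0 0)
    have hcast : (T.closedLeafPath (fam 0) (hleafwise 0 ⟨le_rfl, hε'⟩) (hcl 0 ⟨le_rfl, hε'⟩)).cast e.symm e.symm =
        (F.leafLoop (loopPath γ hc hp) (continuous_toLeafSpace_loopPath γ hc hp)).map hf.continuous_leafMap := by
      ext θ
      exact congrArg (toLeafSpace : M → T.LeafSpace) (hfam0 θ)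
    have hrefl : (Path.refl (toLeafSpace (fam 0 0) : T.LeafSpace)).cast e.symm e.symm =
        Path.refl (leafMap F T f (toLeafSpace (loopBase γ))) := by
      ext θ
      exact e
    have H' := CircleLoops.homotopic_cast e.symm e.symm H
    rwa [hcast, hrefl] at H'
  · -- null for `t > 0`: every loop of an image-null compact leaf has null image
    have ht' : t ∈ Ico 0 ε' := ⟨ht.1.le, ht.2⟩
    have hτ := hlev ht'
    set τ := τ₀ + sg * t with hτdef
    have hIN : ImageNull hf (vert γ e₀ τ) := hband t ⟨ht.1, ht.2.trans_le (min_le_right _ _)⟩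
    obtain ⟨x', γ', hc', hp', hyx', hinj', hsurj', hnull'⟩ := id hIN
    -- re-base the injective loop `γ'` of the leaf at the point `V τ`
    obtain ⟨s₁, hs₁⟩ : (⟨toLeafSpace (vert γ e₀ τ), hyx'⟩ : F.Leaf x') ∈ range γ' := by
      rw [hsurj']; exact mem_univ _
    obtain ⟨hc₁, hp₁, hinj₁, hsurj₁⟩ := CircleLoops.rebase hc' hp' hinj' hsurj' s₁
    set β : ℝ → F.Leaf x' := fun s ↦ γ' (s + s₁) with hβ
    have hβ0 : β 0 = ⟨toLeafSpace (vert γ e₀ τ), hyx'⟩ := by show γ' (0 + s₁) = _; rw [zero_add, hs₁]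
    -- the image of the injective loop `β` is null
    set Φf : C(F.Leaf x', T.LeafSpace) :=
      ⟨fun q ↦ leafMap F T f (q : F.LeafSpace), hf.continuous_leafMap.comp continuous_subtype_val⟩ with hΦf
    have hnullβ : ((CircleLoops.loop hc₁ hp₁).map Φf.continuous).Homotopic (Path.refl _) := by
      have h := hIN.map_loop β hc₁ hp₁ hinj₁ hyx'
      have heq : (CircleLoops.loop hc₁ hp₁).map Φf.continuous =
          (F.leafLoop (loopPath β hc₁ hp₁) (continuous_toLeafSpace_loopPath β hc₁ hp₁)).map hf.continuous_leafMap := by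
        ext θ
        rfl
      rw [heq]
      exact h
    -- the horizontal at level `τ` as a loop of the leaf `F.Leaf x'` at `β 0`
    have hmemleaf : ∀ θ : I, Φ θ τ ∈ F.leaf x' := fun θ ↦ by
      rw [← F.leaf_eq_of_mem hyx', vert_def, ← h0 _ hτ]
      exact hΦ.mem_leaf hτ 0 θ
    set a : F.Leaf x' := ⟨toLeafSpace (Φ 0 τ), hmemleaf 0⟩ with ha
    have ha0 : a = β 0 := by
      rw [hβ0]
      exact Subtype.ext (congrArg (toLeafSpace : X → F.LeafSpace) ((h0 _ hτ).trans (vert_def τ).symm))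
    set hor : Path a a :=
      { toFun := fun θ ↦ ⟨toLeafSpace (Φ θ τ), hmemleaf θ⟩
        continuous_toFun := (hΦ.continuous_toLeafSpace hτ).subtype_mk _
        source' := rfl
        target' := Subtype.ext (congrArg toLeafSpace (hclosed ht')) } with hhor
    have key := CircleLoops.map_homotopic_refl_of_map_loop' hc₁ hp₁ hinj₁ hsurj₁ Φf hnullβ ha0 hor
    have heq : hor.map Φf.continuous = T.closedLeafPath (fam t) (hleafwise t ht') (hcl t ht') := by
      ext θ
      rfl
    rw [heq] at key
    exact key
  · -- transversality: the pushed fence levels injectively in its local datum at `θ`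
    obtain ⟨U, hU, D, hD⟩ := hΦT.local_level θ (mem_univ θ)
    refine ⟨D.box, D.box_mem, 1, one_pos, fun s hs ↦ (hD θ ⟨mem_of_mem_nhds hU, mem_univ θ⟩ _ (hlev₁ hs.1)).1,
      fun s hs s' hs' hss' ↦ ?_⟩
    have h₁ := (hD θ ⟨mem_of_mem_nhds hU, mem_univ θ⟩ _ (hlev₁ hs.1)).2
    have h₂ := (hD θ ⟨mem_of_mem_nhds hU, mem_univ θ⟩ _ (hlev₁ hs'.1)).2
    have h' : D.ψ (τ₀ + sg * s) = D.ψ (τ₀ + sg * s') := by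
      rw [← h₁, ← h₂]
      exact hss'
    have h'' := D.ψ_inj (hlev₁ hs.1) (hlev₁ hs'.1) h'
    have : sg * s = sg * s' := by linarith
    exact mul_left_cancel₀ hsg0 this

end Literature.Topology.PlanarFoliations
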